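import Literature.Topology.FourManifolds.GluckTwistExistence
import Literature.Topology.FourManifolds.FramedTubularNbhd
import HarnessLib

/-!
# Existence of the Gluck twist from a normal framing of the 2-knot (Gluck 1962, §§6, 8, 17)

Theorems only (no definitions, no named facts): this file joins

* `GluckTwistExistence.lean` — `Literature.Topology.FourManifolds.exists_isGluckTwist_of_nonempty_tubularNbhd`: the pushout
  construction of the Gluck twist `(S⁴ ∖ K(S²)) ∪_τ (S² × ℝ²)` along a tubular neighbourhood of
  the 2-knot `K` (Gluck, *The embedding of two-spheres in the four-sphere*, Trans. AMS 104 (1962),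
  §8 (the twist `τ`) and §17), and
* `FramedTubularNbhd.lean` — `Literature.Topology.FourManifolds.TwoKnot.nonempty_tubularNbhd_of_isNormalFraming`: the tubular
  neighbourhood theorem for a normally framed 2-knot (Hirsch, *Differential Topology* (1976),
  Ch. 4, §5, Thms. 5.1–5.2),

so that the named fact `Literature.Topology.FourManifolds.exists_isGluckTwist` (`GluckTwist.lean`), and its route-facing copy
`Literature.Topology.FourManifolds.gluck_exists` (`GluckTwistFacts.lean`), are reduced to the single named fact
`Literature.Topology.FourManifolds.TwoKnot.nonempty_normalFraming` — triviality of the normal bundle of an embedded `S²` in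
`S⁴` (Kirby, *The Topology of 4-Manifolds* (1989), Ch. VIII, Thm. 2: Euler class Poincaré dual to
`[K] · [K] = 0 ∈ H₂(S⁴) = 0`), a statement of algebraic topology not yet within reach of Mathlib:

* `Literature.Topology.FourManifolds.TwoKnot.exists_isGluckTwist_of_isNormalFraming`: a normally framed 2-knot has a Gluck
  twist (a closed smooth 4-manifold `X` with `IsGluckTwist (𝓡 4) X K`);
* `Literature.exists_isGluckTwist_of_nonempty_normalFraming :
    TwoKnot.nonempty_normalFraming → exists_isGluckTwist`;
* `Literature.gluck_exists_of_nonempty_normalFraming : TwoKnot.nonempty_normalFraming → gluck_exists`.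

Hence `exists_isGluckTwist_holds` will be
`exists_isGluckTwist_of_nonempty_normalFraming TwoKnot.nonempty_normalFraming_holds` once that
fact is discharged.

## References

* H. Gluck, *The embedding of two-spheres in the four-sphere*, Trans. Amer. Math. Soc. 104 (1962),
  308–333, §§6, 8, 17. [GluckTAMS1962]
* R. C. Kirby, *The Topology of 4-Manifolds*, LNM 1374 (1989), Ch. VIII, Thms. 2–3 (pp. 44–45).
  [Kirby1989]
* M. W. Hirsch, *Differential Topology*, GTM 33 (1976), Ch. 4, §5, Thms. 5.1–5.2. [HirschDT1976]
-/

open scoped Manifold ContDiff Topology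
open Function Set

noncomputable section

namespace Literature.Topology.FourManifolds

/-- **A normally framed 2-knot has a Gluck twist**: if the 2-knot `K : S² ↪ S⁴` carries a normal
framing `fr` (two smooth vector fields along `K`, tangent to `S⁴`, independent modulo `T K`), then
there is a closed (compact, Hausdorff, second countable) smooth 4-manifold which is a Gluck twist
of `S⁴` along `K` — the pushout along the tubular neighbourhood `h.tube ε` of the framing
(Gluck 1962, §6: tubular neighbourhoods `S² × D²` of 2-spheres in `S⁴`; §§8, 17: the twist).
[cite: GluckTAMS1962, §§8 and 17] -/
theorem TwoKnot.exists_isGluckTwist_of_isNormalFraming (K : TwoKnot)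
    {fr : Fin 2 → Metric.sphere (0 : EuclideanSpace ℝ (Fin 3)) 1 → EuclideanSpace ℝ (Fin 5)}
    (h : IsNormalFraming (𝓡 2) (⇑K) fr) :
    ∃ (X : Type) (_ : TopologicalSpace X) (_ : T2Space X) (_ : SecondCountableTopology X)
      (_ : ChartedSpace (EuclideanSpace ℝ (Fin 4)) X) (_ : IsManifold (𝓡 4) ∞ X)
      (_ : CompactSpace X), IsGluckTwist (𝓡 4) X K :=
  (TwoKnot.nonempty_tubularNbhd_of_isNormalFraming K h).elim fun ν ↦ ν.exists_isGluckTwist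

/-- **Existence of the Gluck twist, reduced to the triviality of the normal bundle of 2-knots**:
`TwoKnot.nonempty_normalFraming → exists_isGluckTwist` (Gluck 1962, §§6, 8, 17; Kirby (1989),
Ch. VIII, Thms. 2–3 for the normal bundle and the tubular neighbourhood `S² × ℝ²`).
[cite: GluckTAMS1962, §§8 and 17] -/
theorem exists_isGluckTwist_of_nonempty_normalFraming (H : TwoKnot.nonempty_normalFraming) :
    exists_isGluckTwist :=
  exists_isGluckTwist_of_nonempty_tubularNbhd
    (TwoKnot.nonempty_tubularNbhd_of_nonempty_normalFraming H)

/-- The route-facing fact `Literature.Topology.FourManifolds.gluck_exists` (`GluckTwistFacts.lean`) likewise follows from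
`TwoKnot.nonempty_normalFraming`. [cite: GluckTAMS1962, §§8 and 17] -/
theorem gluck_exists_of_nonempty_normalFraming (H : TwoKnot.nonempty_normalFraming) :
    gluck_exists :=
  exists_isGluckTwist_of_nonempty_normalFraming H

end Literature.Topology.FourManifolds
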